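import Literature.NumberTheory.EllipticCurves.CongruenceNumber
import Literature.NumberTheory.EllipticCurves.HeckeCongruenceModulus
import HarnessLib

/-!
# Sketch (stub-ideation k=2 · GEN 4 · FAMILY 2 RESHAPE) for `stub_xiDegreeComparison` of crux
# `SteinbergCore` (route-ABC-DefiniteXi): the BRANDT-FREE KERNEL of the theta-lattice congruence
# transfer (gen 3, `STUB_IDEAS_stub_xiDegreeComparison_2_SketchG3.lean`, ns `…ThetaTransferG3`).

Gen-4 deltas: (β) the one arithmetic step of H5core isolated as a lemma about `S_k(Γ₀(N); ℤ)` ALONE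
(`ξ • g = n • f + h`, `h ⊥ f` integral ⟹ `ξ ∣ |n| · r_f`; gcd + Bezout + the tree's PROVED
`dvd_congruenceNumber_of_sub_eq_smul`), and (T) the TRANSFER TEMPLATE: for ANY map `Θ` from the
degree-zero lattice of `ℤ^ι` to cusp forms that is additive, `ℤ`-homogeneous, integral-valued, sends
`φ` to `m • f` and `w`-orthogonal-to-`φ` vectors to Petersson-orthogonal-to-`f` forms, and any weights
with `ξ = Σ w_c φ_c²`: `ξ ∣ |m ⟨φ,y⟩_w| · r_f` for every degree-zero `y`.  Gen 3's H2b/H3/H4 are exactly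
the template's hypotheses for `Θ := Θ_i` (row theta lift), `m := 2 w_i φ_i`; H5core is (T); nothing
Brandt-specific remains in the arithmetic.
-/

set_option linter.dupNamespace false

noncomputable section

namespace Summit.ABC.ABC.Cruxes.SteinbergCore.ThetaTransferG4

open scoped MatrixGroups ModularForm Matrix
open CongruenceSubgroup
open Literature.NumberTheory.EllipticCurves.ModularForms

/-! ## (β) the Brandt-free kernel: a congruence `ξ g ≡ n f (mod f^⊥)` forces `ξ ∣ |n| · r_f` -/

/-- **(β) kernel lemma.** If `0 ≠ f`, `g` are integral cusp forms on `Γ₀(N)`, `h ∈ (ℤf)^⊥` and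
`ξ • g = n • f + h` with `ξ ≠ 0`, then `ξ ∣ |n| · r_f`.  Proof: `d := gcd(ξ, n)`, `ξ = d ξ₁`,
`n = d n₁`, `u ξ₁ + v n₁ = 1`; `h' := ξ₁ g − n₁ f ∈ (ℤf)^⊥` (as `d • h' = h`); then
`f − (−v h') = ξ₁ • (u f + v g)`, so `ξ₁ ∣ r_f` (`dvd_congruenceNumber_of_sub_eq_smul`) and
`ξ = d ξ₁ ∣ |n| r_f`. -/
theorem dvd_natAbs_mul_congruenceNumber_of_smul_eq {N : ℕ} [NeZero N] {k : ℤ}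
    {f g h : CuspForm (Gamma0 N) k} (hf : f ≠ 0)
    (hfI : f ∈ integralCuspForms0 N k) (hgI : g ∈ integralCuspForms0 N k)
    (hh : h ∈ integralOrthogonal0 f) {ξ : ℕ} (hξ : ξ ≠ 0) {n : ℤ}
    (e : (ξ : ℂ) • g = (n : ℂ) • f + h) : ξ ∣ n.natAbs * congruenceNumber f := by
  -- `d = gcd(ξ, n) > 0`, `ξ = d ξ₁`, `n = d n₁`, `u ξ₁ + v n₁ = 1`
  set d : ℕ := Int.gcd (ξ : ℤ) n with hd
  have hdpos : 0 < d := Int.gcd_pos_of_ne_zero_left n (by exact_mod_cast hξ)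
  have hdξ : (d : ℤ) ∣ (ξ : ℤ) := Int.gcd_dvd_left _ _
  have hdn : (d : ℤ) ∣ n := Int.gcd_dvd_right _ _
  set ξ₁ : ℤ := (ξ : ℤ) / d with hξ₁
  set n₁ : ℤ := n / d with hn₁
  have hξd : (ξ : ℤ) = d * ξ₁ := (Int.mul_ediv_cancel' hdξ).symm
  have hnd : n = d * n₁ := (Int.mul_ediv_cancel' hdn).symm
  have hcop : Int.gcd ξ₁ n₁ = 1 := Int.gcd_div_gcd_div_gcd hdpos
  obtain ⟨u, v, huv⟩ := Int.isCoprime_iff_gcd_eq_one.mpr hcop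
  have hξ₁nn : 0 ≤ ξ₁ := Int.ediv_nonneg (by positivity) (by positivity)
  -- the Petersson pairing with `f`
  set P : CuspForm (Gamma0 N) k →ₗ[ℂ] ℂ := peterssonProductₗ (Gamma0 N) k f with hP
  have hPh : P h = 0 := (mem_integralOrthogonal0.mp hh).2
  -- `h' := ξ₁ g − n₁ f` is integral, and `d • h' = h` makes it orthogonal to `f`
  set h' : CuspForm (Gamma0 N) k := (ξ₁ : ℂ) • g - (n₁ : ℂ) • f with hh'
  have hh'I : h' ∈ integralCuspForms0 N k := by
    rw [hh', Int.cast_smul_eq_zsmul, Int.cast_smul_eq_zsmul]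
    exact Submodule.sub_mem _ (Submodule.smul_mem _ _ hgI) (Submodule.smul_mem _ _ hfI)
  have hdh' : (d : ℂ) • h' = h := by
    have e' : h = (ξ : ℂ) • g - (n : ℂ) • f := by rw [e]; abel
    have hξC : (ξ : ℂ) = (d : ℂ) * (ξ₁ : ℂ) := by exact_mod_cast hξd
    have hnC : (n : ℂ) = (d : ℂ) * (n₁ : ℂ) := by exact_mod_cast hnd
    rw [e', hh', smul_sub, smul_smul, smul_smul, ← hξC, ← hnC]
  have hPh' : P h' = 0 := by
    have := congrArg P hdh'
    rw [map_smul, hPh, smul_eq_mul, mul_eq_zero] at this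
    exact this.resolve_left (by exact_mod_cast hdpos.ne')
  have hh'orth : h' ∈ integralOrthogonal0 f := mem_integralOrthogonal0.mpr ⟨hh'I, hPh'⟩
  -- `f − (−v h') = ξ₁ • (u f + v g)`
  set r : ℕ := ξ₁.toNat with hr
  have hrξ₁ : (r : ℤ) = ξ₁ := Int.toNat_of_nonneg hξ₁nn
  have hrC : (r : ℂ) = (ξ₁ : ℂ) := by exact_mod_cast hrξ₁
  have hg₁ : -(v • h') ∈ integralOrthogonal0 f :=
    (integralOrthogonal0 f).neg_mem ((integralOrthogonal0 f).smul_mem v hh'orth)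
  have hh₁ : u • f + v • g ∈ integralCuspForms0 N k :=
    Submodule.add_mem _ (Submodule.smul_mem _ _ hfI) (Submodule.smul_mem _ _ hgI)
  have huvC : (u : ℂ) * ξ₁ + v * n₁ = 1 := by exact_mod_cast huv
  have key : f - -(v • h') = r • (u • f + v • g) := by
    rw [← Nat.cast_smul_eq_nsmul ℂ, hrC, ← Int.cast_smul_eq_zsmul ℂ v, ← Int.cast_smul_eq_zsmul ℂ u,
      ← Int.cast_smul_eq_zsmul ℂ v, hh']
    match_scalars <;> first | ring1 | linear_combination -huvC
  have hr_dvd : r ∣ congruenceNumber f := dvd_congruenceNumber_of_sub_eq_smul hf hg₁ hh₁ key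
  -- `ξ = d r ∣ |n| · r_f`
  have hξdr : ξ = d * r := by
    have : (ξ : ℤ) = d * r := by rw [hrξ₁]; exact hξd
    exact_mod_cast this
  have hdn' : d ∣ n.natAbs := Int.natCast_dvd.mp hdn
  rw [hξdr]
  exact Nat.mul_dvd_mul hdn' hr_dvd

/-! ## (T) the transfer template: gen 3's H2b + H3 + H4 are exactly its hypotheses -/

/-- **(T) transfer template (Brandt-free).**  Let `w : ι → ℕ`, `φ : ι → ℤ`, `ξ ≠ 0` with
`ξ = Σ_c w_c |φ_c|²` (VERBATIM the shape of the tree's `Brandt.xi_eq_sum` on the eigen-line), `φ` of degree zero, and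
`Θ : ℤ^ι → S_k(Γ₀(N))` additive and `ℤ`-homogeneous on degree-zero vectors, integral-valued there,
with `Θ φ = m • f` (H3: `m = 2 w_i φ_i`) and `Θ z ⊥ f` whenever `z` has degree zero and `⟨φ, z⟩_w = 0`
(H4).  Then for every degree-zero `y`: `ξ ∣ |m ⟨φ, y⟩_w| · r_f` — apply (β) to
`ξ • Θ y = (m⟨φ,y⟩_w) • f + Θ(ξ y − ⟨φ,y⟩_w φ)`. -/
theorem dvd_natAbs_mul_congruenceNumber_of_transfer {ι : Type*} [Fintype ι] {N : ℕ} [NeZero N]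
    {k : ℤ} (w : ι → ℕ) (φ : ι → ℤ) {ξ : ℕ} (hξ : ξ ≠ 0)
    (hξw : ξ = ∑ c, w c * (φ c).natAbs ^ 2)
    (hφ : ∑ c, φ c = 0) {f : CuspForm (Gamma0 N) k} (hf : f ≠ 0) (hfI : f ∈ integralCuspForms0 N k)
    (Θ : (ι → ℤ) → CuspForm (Gamma0 N) k)
    (hadd : ∀ v v' : ι → ℤ, ∑ c, v c = 0 → ∑ c, v' c = 0 → Θ (v + v') = Θ v + Θ v')
    (hsmul : ∀ (a : ℤ) (v : ι → ℤ), ∑ c, v c = 0 → Θ (a • v) = (a : ℂ) • Θ v)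
    (hint : ∀ v : ι → ℤ, ∑ c, v c = 0 → Θ v ∈ integralCuspForms0 N k)
    {m : ℤ} (hφf : Θ φ = (m : ℂ) • f)
    (horth : ∀ z : ι → ℤ, ∑ c, z c = 0 → ∑ c, (w c : ℤ) * φ c * z c = 0 →
      peterssonProduct (Gamma0 N) k f (Θ z) = 0)
    {y : ι → ℤ} (hy : ∑ c, y c = 0) :
    ξ ∣ (m * ∑ c, (w c : ℤ) * φ c * y c).natAbs * congruenceNumber f := by
  -- `ξ = Σ w φ²` over `ℤ`
  have hξw' : (ξ : ℤ) = ∑ c, (w c : ℤ) * φ c * φ c := by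
    rw [hξw]
    push_cast
    refine Finset.sum_congr rfl fun c _ => ?_
    rw [sq_abs]
    ring
  set s : ℤ := ∑ c, (w c : ℤ) * φ c * y c with hs
  -- `z := ξ y − ⟨φ,y⟩_w φ` has degree zero and is `w`-orthogonal to `φ`
  set z : ι → ℤ := ((ξ : ℤ) • y) + ((-s) • φ) with hz
  have hξy : ∑ c, ((ξ : ℤ) • y) c = 0 := by
    simp only [Pi.smul_apply, smul_eq_mul, ← Finset.mul_sum, hy, mul_zero]
  have hsφ : ∑ c, ((-s) • φ) c = 0 := by
    simp only [Pi.smul_apply, smul_eq_mul, ← Finset.mul_sum, hφ, mul_zero]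
  have hz0 : ∑ c, z c = 0 := by
    have : ∑ c, z c = ∑ c, ((ξ : ℤ) • y) c + ∑ c, ((-s) • φ) c := by
      rw [← Finset.sum_add_distrib]
      rfl
    rw [this, hξy, hsφ, add_zero]
  have hzorth : ∑ c, (w c : ℤ) * φ c * z c = 0 := by
    have hc : ∀ c, (w c : ℤ) * φ c * z c =
        (ξ : ℤ) * ((w c : ℤ) * φ c * y c) - s * ((w c : ℤ) * φ c * φ c) := by
      intro c
      simp only [hz, Pi.add_apply, Pi.smul_apply, smul_eq_mul]
      ring
    simp_rw [hc, Finset.sum_sub_distrib, ← Finset.mul_sum, ← hξw', ← hs]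
    ring
  -- `Θ z = ξ Θ y − (m s) f`, i.e. `ξ • Θ y = (m s) • f + Θ z`
  have hΘz : Θ z = (ξ : ℂ) • Θ y + ((-s : ℤ) : ℂ) • ((m : ℂ) • f) := by
    rw [hz, hadd _ _ hξy hsφ, hsmul _ _ hy, hsmul _ _ hφ, hφf]
    push_cast
    rfl
  have e : (ξ : ℂ) • Θ y = ((m * s : ℤ) : ℂ) • f + Θ z := by
    rw [hΘz, smul_smul]
    push_cast
    module
  have hzO : Θ z ∈ integralOrthogonal0 f :=
    mem_integralOrthogonal0.mpr ⟨hint z hz0, horth z hz0 hzorth⟩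
  exact dvd_natAbs_mul_congruenceNumber_of_smul_eq hf hfI (hint y hy) hzO hξ e

/-! ## H4 re-cut over the tree's anemic Hecke ring `𝕋 = ℤ[T_p : p ∤ N]` (`anemicHeckeRing N k`,
`HeckeCongruenceModulus.lean`): self-adjointness of `𝕋` (H4a′), transport of a Brandt-side
polynomial in the `T(p)` to `𝕋` along any `T(p)`-equivariant `Θ` (H4b′), and the orthogonality
template (O) fed by the integral projector `ξ M = D φ φᵀ W` of `Brandt.exists_heckeProjector`. -/

/-- **H4a′ (S): every element of `𝕋 = ℤ[T_p : p ∤ N]` is Petersson-self-adjoint.**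
`Algebra.adjoin_induction`: generators by `heckeT_selfAdjoint_holds` (Diamond–Shurman Thm. 5.5.3,
PROVED), `algebraMap ℤ` by (conjugate-)linearity at an integer, sums trivially, products by
`⟨st·f, g⟩ = ⟨t f, s g⟩ = ⟨f, t s g⟩` and commutativity of `𝕋` (`instCommRingAnemicHeckeRing`). -/
theorem peterssonProduct_anemicHecke_symm {N : ℕ} [NeZero N] {k : ℤ} (t : anemicHeckeRing N k)
    (f g : CuspForm (Gamma0 N) k) :
    peterssonProduct (Gamma0 N) k ((t : Module.End ℂ (CuspForm (Gamma0 N) k)) f) g =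
      peterssonProduct (Gamma0 N) k f ((t : Module.End ℂ (CuspForm (Gamma0 N) k)) g) := by
  obtain ⟨x, hx⟩ := t
  change peterssonProduct (Gamma0 N) k (x f) g = peterssonProduct (Gamma0 N) k f (x g)
  replace hx : x ∈ Algebra.adjoin ℤ (anemicHeckeGenerators N k) := hx
  induction hx using Algebra.adjoin_induction generalizing f g with
  | mem y hy =>
    obtain ⟨p, hp, hpN, rfl⟩ := hy
    haveI : NeZero p := ⟨hp.ne_zero⟩
    exact heckeT_selfAdjoint_holds N k p hp hpN f g
  | algebraMap r =>
    rw [eq_intCast, Module.End.intCast_apply, Module.End.intCast_apply,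
      ← Int.cast_smul_eq_zsmul ℂ, ← Int.cast_smul_eq_zsmul ℂ, peterssonProduct_smul_left,
      peterssonProduct_smul_right, map_intCast]
  | add x y hx hy ihx ihy =>
    rw [LinearMap.add_apply, LinearMap.add_apply, peterssonProduct_add_left,
      peterssonProduct_add_right, ihx, ihy]
  | mul x y hx hy ihx ihy =>
    have hcomm : x * y = y * x :=
      congrArg Subtype.val (mul_comm (⟨x, hx⟩ : anemicHeckeRing N k) ⟨y, hy⟩)
    conv_rhs => rw [hcomm]
    rw [Module.End.mul_apply, Module.End.mul_apply, ihx, ihy]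

/-- **H4b′ (S): transport along an equivariant lift.**  If `Θ` (additive and `ℤ`-homogeneous on the
degree-zero lattice, which the `T(p)`, `p ∤ N`, preserve) intertwines `T(p)` with `T_p` for every
prime `p ∤ N`, then every `M ∈ ℤ[T(p) : p ∤ N]` is intertwined with SOME `t ∈ 𝕋`
(`Algebra.adjoin_induction`, or `Algebra.adjoin_eq_range` + `MvPolynomial.induction_on` as in
`anemicHeckeRing.exists_eq_aeval`). -/
theorem exists_anemicHecke_transport {ι : Type*} [Fintype ι] [DecidableEq ι] {N : ℕ} [NeZero N]
    {k : ℤ} (T : ℕ → Matrix ι ι ℤ) (Θ : (ι → ℤ) → CuspForm (Gamma0 N) k)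
    (hdeg : ∀ p : ℕ, p.Prime → ¬ p ∣ N → ∀ v : ι → ℤ, ∑ c, v c = 0 → ∑ c, (T p *ᵥ v) c = 0)
    (hadd : ∀ v v' : ι → ℤ, ∑ c, v c = 0 → ∑ c, v' c = 0 → Θ (v + v') = Θ v + Θ v')
    (hsmul : ∀ (a : ℤ) (v : ι → ℤ), ∑ c, v c = 0 → Θ (a • v) = (a : ℂ) • Θ v)
    (hequiv : ∀ (p : ℕ) (hp : p.Prime), ¬ p ∣ N → ∀ v : ι → ℤ, ∑ c, v c = 0 →
      (haveI : NeZero p := ⟨hp.ne_zero⟩; heckeT (Gamma0 N) k p (Θ v)) = Θ (T p *ᵥ v))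
    {M : Matrix ι ι ℤ}
    (hM : M ∈ Algebra.adjoin ℤ {X : Matrix ι ι ℤ | ∃ p : ℕ, p.Prime ∧ ¬ p ∣ N ∧ X = T p}) :
    ∃ t : anemicHeckeRing N k, ∀ v : ι → ℤ, ∑ c, v c = 0 →
      (t : Module.End ℂ (CuspForm (Gamma0 N) k)) (Θ v) = Θ (M *ᵥ v) := by
  -- induct on `M ∈ ℤ[T(p) : p ∤ N]`, carrying degree-preservation along
  suffices h : (∀ v : ι → ℤ, ∑ c, v c = 0 → ∑ c, (M *ᵥ v) c = 0) ∧
      ∃ t : anemicHeckeRing N k, ∀ v : ι → ℤ, ∑ c, v c = 0 →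
        (t : Module.End ℂ (CuspForm (Gamma0 N) k)) (Θ v) = Θ (M *ᵥ v) from h.2
  induction hM using Algebra.adjoin_induction with
  | mem X hX =>
    obtain ⟨p, hp, hpN, rfl⟩ := hX
    haveI : NeZero p := ⟨hp.ne_zero⟩
    exact ⟨hdeg p hp hpN, anemicHeckeRing.T N k p hp hpN, fun v hv => by
      rw [anemicHeckeRing.coe_T]; exact hequiv p hp hpN v hv⟩
  | algebraMap r =>
    have hr : ∀ v : ι → ℤ, (algebraMap ℤ (Matrix ι ι ℤ) r) *ᵥ v = r • v := fun v => by
      rw [Algebra.algebraMap_eq_smul_one, Matrix.smul_mulVec, Matrix.one_mulVec]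
    refine ⟨fun v hv => ?_, algebraMap ℤ (anemicHeckeRing N k) r, fun v hv => ?_⟩
    · rw [hr]
      simp only [Pi.smul_apply, smul_eq_mul, ← Finset.mul_sum, hv, mul_zero]
    · rw [hr, hsmul r v hv, Subalgebra.coe_algebraMap, eq_intCast, Module.End.intCast_apply,
        Int.cast_smul_eq_zsmul]
  | add X Y hX hY ihX ihY =>
    obtain ⟨hdX, tX, htX⟩ := ihX
    obtain ⟨hdY, tY, htY⟩ := ihY
    refine ⟨fun v hv => ?_, tX + tY, fun v hv => ?_⟩
    · rw [Matrix.add_mulVec, Finset.sum_congr rfl fun c _ => Pi.add_apply _ _ c,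
        Finset.sum_add_distrib, hdX v hv, hdY v hv, add_zero]
    · rw [Matrix.add_mulVec, hadd _ _ (hdX v hv) (hdY v hv), ← htX v hv, ← htY v hv,
        Subalgebra.coe_add, LinearMap.add_apply]
  | mul X Y hX hY ihX ihY =>
    obtain ⟨hdX, tX, htX⟩ := ihX
    obtain ⟨hdY, tY, htY⟩ := ihY
    refine ⟨fun v hv => ?_, tX * tY, fun v hv => ?_⟩
    · rw [← Matrix.mulVec_mulVec]
      exact hdX _ (hdY v hv)
    · rw [← Matrix.mulVec_mulVec, ← htX _ (hdY v hv), ← htY v hv, Subalgebra.coe_mul,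
        Module.End.mul_apply]

/-- **(O) orthogonality template (S): `z ⊥_w φ ⟹ Θ z ⊥ f`.**  With the projector identity
`ξ M_{cd} = D w_d φ_d φ_c` (`Brandt.exists_heckeProjector`, verbatim), `ξ = Σ w |φ|²`, a transported
`t ∈ 𝕋` for `M` (H4b′) and self-adjointness (H4a′): `M z = 0` and `M φ = D φ` (divide by `ξ ≠ 0`),
so `t (Θ φ) = D • Θ φ`, i.e. `t f = D f` (`m ≠ 0`), and
`D ⟨f, Θ z⟩ = ⟨t f, Θ z⟩ = ⟨f, t (Θ z)⟩ = ⟨f, Θ (M z)⟩ = ⟨f, Θ 0⟩ = 0`. -/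
theorem peterssonProduct_transfer_eq_zero {ι : Type*} [Fintype ι] [DecidableEq ι] {N : ℕ}
    [NeZero N] {k : ℤ} (w : ι → ℕ) (φ : ι → ℤ) {ξ D : ℕ} (hξ : ξ ≠ 0) (hD : 0 < D)
    (hξw : ξ = ∑ c, w c * (φ c).natAbs ^ 2) {M : Matrix ι ι ℤ}
    (hproj : ∀ c d : ι, (ξ : ℤ) * M c d = (D : ℤ) * (w d : ℤ) * φ d * φ c)
    {f : CuspForm (Gamma0 N) k} (Θ : (ι → ℤ) → CuspForm (Gamma0 N) k)
    (hsmul : ∀ (a : ℤ) (v : ι → ℤ), ∑ c, v c = 0 → Θ (a • v) = (a : ℂ) • Θ v)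
    {t : anemicHeckeRing N k}
    (ht : ∀ v : ι → ℤ, ∑ c, v c = 0 → (t : Module.End ℂ (CuspForm (Gamma0 N) k)) (Θ v) = Θ (M *ᵥ v))
    (hsymm : ∀ g g' : CuspForm (Gamma0 N) k,
      peterssonProduct (Gamma0 N) k ((t : Module.End ℂ (CuspForm (Gamma0 N) k)) g) g' =
        peterssonProduct (Gamma0 N) k g ((t : Module.End ℂ (CuspForm (Gamma0 N) k)) g'))
    (hφ : ∑ c, φ c = 0) {m : ℤ} (hm : m ≠ 0) (hφf : Θ φ = (m : ℂ) • f)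
    {z : ι → ℤ} (hz : ∑ c, z c = 0) (hzorth : ∑ c, (w c : ℤ) * φ c * z c = 0) :
    peterssonProduct (Gamma0 N) k f (Θ z) = 0 := by
  have hξ0 : (ξ : ℤ) ≠ 0 := by exact_mod_cast hξ
  -- `ξ = Σ w φ²` over `ℤ`
  have hξw' : (ξ : ℤ) = ∑ c, (w c : ℤ) * φ c * φ c := by
    rw [hξw]
    push_cast
    refine Finset.sum_congr rfl fun c _ => ?_
    rw [sq_abs]
    ring
  -- `M z = 0` and `M φ = D φ`
  have hMz : M *ᵥ z = 0 := by
    funext c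
    have h1 : (ξ : ℤ) * (M *ᵥ z) c = 0 := by
      simp only [Matrix.mulVec, dotProduct, Finset.mul_sum]
      have hc : ∀ d, (ξ : ℤ) * (M c d * z d) = (D : ℤ) * φ c * ((w d : ℤ) * φ d * z d) := by
        intro d
        rw [← mul_assoc, hproj]
        ring
      simp_rw [hc, ← Finset.mul_sum, hzorth, mul_zero]
    exact (mul_eq_zero.mp h1).resolve_left hξ0
  have hMφ : M *ᵥ φ = (D : ℤ) • φ := by
    funext c
    have h1 : (ξ : ℤ) * (M *ᵥ φ) c = (ξ : ℤ) * ((D : ℤ) * φ c) := by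
      simp only [Matrix.mulVec, dotProduct, Finset.mul_sum]
      have hc : ∀ d, (ξ : ℤ) * (M c d * φ d) = (D : ℤ) * φ c * ((w d : ℤ) * φ d * φ d) := by
        intro d
        rw [← mul_assoc, hproj]
        ring
      simp_rw [hc, ← Finset.mul_sum, ← hξw']
      ring
    rw [Pi.smul_apply, smul_eq_mul]
    exact mul_left_cancel₀ hξ0 h1
  -- `t f = D f`
  have htφ : (t : Module.End ℂ (CuspForm (Gamma0 N) k)) (Θ φ) = (D : ℂ) • Θ φ := by
    rw [ht φ hφ, hMφ, hsmul _ _ hφ]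
    push_cast
    rfl
  have hm0 : (m : ℂ) ≠ 0 := by exact_mod_cast hm
  have htf : (t : Module.End ℂ (CuspForm (Gamma0 N) k)) f = (D : ℂ) • f := by
    have h1 : (m : ℂ) • (t : Module.End ℂ (CuspForm (Gamma0 N) k)) f = (m : ℂ) • ((D : ℂ) • f) := by
      rw [← map_smul, ← hφf, htφ, hφf, smul_comm]
    exact smul_right_injective _ hm0 h1
  -- `t (Θ z) = 0`
  have hΘ0 : Θ 0 = 0 := by
    have h0 := hsmul 0 z hz
    rw [zero_smul, Int.cast_zero, zero_smul] at h0
    exact h0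
  have htz : (t : Module.End ℂ (CuspForm (Gamma0 N) k)) (Θ z) = 0 := by
    rw [ht z hz, hMz, hΘ0]
  -- `D ⟨f, Θ z⟩ = ⟨D f, Θ z⟩ = ⟨t f, Θ z⟩ = ⟨f, t Θ z⟩ = 0`
  have key : (starRingEnd ℂ) (D : ℂ) * peterssonProduct (Gamma0 N) k f (Θ z) = 0 := by
    rw [← peterssonProduct_smul_left, ← htf, hsymm, htz, peterssonProduct_zero_right]
  have hD0 : (starRingEnd ℂ) (D : ℂ) ≠ 0 := by
    rw [Complex.conj_natCast]
    exact_mod_cast hD.ne'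
  exact (mul_eq_zero.mp key).resolve_left hD0

end Summit.ABC.ABC.Cruxes.SteinbergCore.ThetaTransferG4

end
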